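import Summits.BirchSwinnertonDyer.Rank1Residual.ManinAdditive.IsogenyEdgeLaws
import HarnessLib

/-!
# Edges for the leaf `IsogenyEdgeLaws` (cell `bsd-f2-manin`, E-imc-12 / E-imc-13 / E-imc-14)

PROVED placement edge from the planner's sketch (HOME/imc/Sketch-imc-g3.lean 187cb8cf2cd306de, glue theorem
`rootEdge_rise_noGain`, VERBATIM): the root-edge law E-imc-12 `RootEdgeGainOnlyByDrop p` CONTAINS the RISE half of
the Néron-scalar law (E-imc-11, the cell's THEOREM T1 — in print as Klagsbrun 2017 Thm 1 + Dokchitser–Dokchitser 2015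
Lemma 12, a Literature item) at bad potentially-good primes: a `Δ_min`-rise is not a drop, so E-imc-12 gives
`v_p c(D₂) = v_p c(D)` there.  A sanity edge showing the two rows are typed over the same configuration; the DROP
half of E-imc-11 is exactly the theorem-side input that E-imc-12 exempts.  No `sorry`; the leaf stays conjecture-only.
-/

noncomputable section

open scoped MatrixGroups ModularForm

open CongruenceSubgroup WeierstrassCurve
  Literature.NumberTheory.EllipticCurves Literature.NumberTheory.EllipticCurves.ModularForms

namespace Summit.BirchSwinnertonDyer.Rank1Residual.ManinAdditive

/-- Glue (proved): under E-imc-12 `RootEdgeGainOnlyByDrop p`, a `Δ_min`-RISING `p`-isogeny `φ : W → W₂` out of the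
optimal curve at a bad prime `p ∣ N(W)` (with `deg D₂ = p·deg D`) does not change the Manin `p`-part:
`v_p c(D₂) = v_p c(D)` — a rise is not a drop. [cite: DokchitserDokchitser2015LocalInvariants, Table 1 and Lemma 12 (the Néron scalar of a p-isogeny; the edge itself is elementary and proved here)] -/
theorem rootEdge_rise_noGain (p : ℕ) (h : RootEdgeGainOnlyByDrop p)
    (W W₂ : WeierstrassCurve ℚ) [W.IsElliptic] [W.IsGloballyMinimal] [W₂.IsElliptic]
    [W₂.IsGloballyMinimal] [NeZero (W.conductorNorm ℤ)]
    (D : ModularParametrizationData W (W.conductorNorm ℤ))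
    (D₂ : ModularParametrizationData W₂ (W.conductorNorm ℤ)) (φ : WeierstrassCurve.Isogeny W W₂)
    (hp : p.Prime) (hopt : ∀ z ∈ D.L.lattice, ∃ w ∈ periodLattice D.f, z = D.c * w)
    (hdeg : φ.degree = p) (hD₂ : D₂.deg = p * D.deg) (hbad : (p : ℤ) ∣ W.conductorNorm ℤ)
    (hrise : padicValInt p W.minimalDiscriminantInt < padicValInt p W₂.minimalDiscriminantInt) :
    padicValInt p D₂.c = padicValInt p D.c :=
  h W W₂ D D₂ φ hp hopt hdeg hD₂ hbad (fun ⟨_, hlt⟩ => lt_asymm hlt hrise)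

end Summit.BirchSwinnertonDyer.Rank1Residual.ManinAdditive

end
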